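import Summits.Ventures.QEC.Census.IPCertificate
import Literature.InformationTheory.QuantumCodes.RefinedLPBoundAdditive
import HarnessLib

/-!
# Certificates for CRSS's linear program refined with respect to a codeword (§7 (ii)): checker, soundness, assembly

Venture QEC (cell `qec`, LADDER-QEC rung X1; row 06). `Literature/…/RefinedLPBoundAdditive.lean` types CRSS's refined
LP [CalderbankEtAl1998, §7 (ii)] WITH INTEGRALITY as `CRSSRefinedFeasible n k d w₀` — unknowns `A_j, B_j, W_j ∈ ℕ` and
refined distributions `R, R' : ℕ³ → ℕ` of `C`, `C⊥` relative to a codeword `u₀` of weight `w₀`, the refined MacWilliams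
identity stated at every integer point — and PROVES it for every additive code containing such a `u₀`. This file is
OUR side, the refined analogue of `IPCertificate.lean`:

* `RTree` — branch-and-bound certificates over the unknowns `(A, B, W, R, R')`: a `split` is an integer linear form
  `≤ v ∨ ≥ v + 1` (valid by integrality); a `leaf` carries multipliers BY FAMILY (base rows of the plain system,
  marginal rows, finitely many EVALUATION POINTS of the refined identity chosen by the certificate, zero rows
  (odd `c` / outside the triangle), translation rows, containment rows, the two unit rows, the splits on the path), so
  that the per-unknown combined coefficient is a closed formula of cost `O(#points)` — weak duality as in
  `LPCertificate.kappa`;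
* `RTree.check n k d e w₀ t` (pure, `decide`-able) and `not_crssRefinedFeasible_of_check`;
* `IPTree.checkZ` — the plain checker of `IPCertificate.lean` with extra rows `A_w = 0`, `w ∈ zs` (the case «`C` has
  NO word of weight `w`»), and `not_sat_checkZ`;
* the ASSEMBLY `no_additiveCode_of_certs`: plain certificates with `A_w = 0 (w ∈ zs)` for `e = 0, 1` + refined
  certificates for every `w ∈ zs` and `e = 0, 1` ⇒ no `[[n,k,d]]` additive code without weight-one stabilizer words —
  CRSS's two-stage argument «Linear programming shows that `C` must contain a vector of weight 12 … adding these
  constraints to the refined weight enumerator produces a linear program with no feasible solution».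

HONEST FRAMING: nonexistence only; nothing here certifies a distance; the certificates for the β cells land as DATA
files `Census/IPBounds/…`. References: [CalderbankEtAl1998, §7 (printed pp. 26–28)]; [MacWilliamsSloane1977, Ch. 17 §4
Thm. 20] (dual vectors as certificates).
-/

namespace Summit.Ventures.QEC.Census

open Finset Literature.InformationTheory.QuantumCodes

/-! ### 1. The plain checker with extra rows `A_w = 0` -/

/-- The row `A_w = 0`. [cite: CalderbankEtAl1998, §7 (ii) («C must contain a vector of weight 12»: the complementary case)] -/
def zeroARow (w : ℕ) : IPRow := ⟨ind w 1, fun _ => 0, fun _ => 0, 0, true⟩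

/-- The plain checker with the extra rows `A_w = 0`, `w ∈ zs`, appended to the base rows. Column: definition (ours).
[cite: CalderbankEtAl1998, §7 Thm. 21 and (ii)] -/
def IPTree.checkZ (n k d e : ℕ) (zs : List ℕ) (t : IPTree) : Bool :=
  t.checkRows n (baseRows n k d e ++ zs.map zeroARow)

/-- Soundness of `checkZ`: a solution of the plain integer system with `A_w = 0` for all `w ∈ zs` is refuted.
[cite: MacWilliamsSloane1977, Ch. 17 §4 Thm. 20] -/
theorem not_sat_checkZ {n k d e : ℕ} {zs : List ℕ} {t : IPTree} (h : t.checkZ n k d e zs = true)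
    {A B W : ℕ → ℕ} (hsys : CRSSIntSystem n k d A B W e) (hz : ∀ w ∈ zs, A w = 0) : False := by
  obtain ⟨-, h0, h1, hsum, hpar, hB, hW, heq, hle, hBW, hpure⟩ := hsys
  refine not_sat_of_checkRows (A := A) (B := B) (W := W) t h fun r hr => ?_
  rcases List.mem_append.1 hr with hr | hr
  · exact sat_baseRows (n := n) h0 h1 hsum hpar hB hW heq hle hBW hpure r hr
  · obtain ⟨w, hw, rfl⟩ := List.mem_map.1 hr
    simp only [zeroARow, IPRow.Sat, ↓reduceIte, IPRow.eval, zero_mul, add_zero, sum_ind_mul]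
    split_ifs
    · rw [hz w hw]; simp
    · rfl

/-! ### 2. Refined certificates -/

/-- Triple-indexed multiplier / coefficient tables as nested lists (missing entries `0`). [folklore] -/
def get3 (l : List (List (List ℤ))) (a b c : ℕ) : ℤ := ((l.getD a []).getD b []).getD c 0

/-- A split of the refined system: integer coefficient lists for `A_j, B_j, W_j` and tables for `R, R'`, a value `v`,
and the side taken (`ge = false`: `form ≤ v`; `ge = true`: `form ≥ v + 1`). Column: definition (ours). [folklore] -/
structure RSplit where
  /-- coefficients of `A_j` -/
  ca : List ℤ
  /-- coefficients of `B_j` -/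
  cb : List ℤ
  /-- coefficients of `W_j` -/
  cw : List ℤ
  /-- coefficients of `R(a,b,c)` -/
  cr : List (List (List ℤ))
  /-- coefficients of `R'(a,b,c)` -/
  crp : List (List (List ℤ))
  /-- the split value -/
  v : ℤ
  /-- side: `false` = `≤ v`, `true` = `≥ v + 1` -/
  ge : Bool

namespace RSplit

/-- The sign with which the split row enters (`≤ v` is `−form ≥ −v`). [folklore] -/
def sgn (s : RSplit) : ℤ := if s.ge then 1 else -1

/-- Right-hand side of the split row as a `≥`-row: `v + 1` resp. `−v`. [folklore] -/
def rhs (s : RSplit) : ℤ := if s.ge then s.v + 1 else -s.v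

end RSplit

/-- A **leaf** of a refined certificate: multipliers by family. Column: definition (ours).
[cite: MacWilliamsSloane1977, Ch. 17 §4 Thm. 20] -/
structure RLeaf where
  /-- multipliers of the base rows of the plain system (`baseRows n k d e`, in order) -/
  base : List ℤ
  /-- `λ_j`: multipliers of the marginal rows `Σ_{a+b+c=j} R = A_j` -/
  lamR : List ℤ
  /-- `λ'_j`: multipliers of the marginal rows `Σ_{a+b+c=j} R' = B_j` -/
  lamRp : List ℤ
  /-- evaluation points `(x₀,x₁,y₀,y₁,y₂)` of the refined MacWilliams identity with their multipliers -/
  pts : List ((ℤ × ℤ × ℤ × ℤ × ℤ) × ℤ)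
  /-- multipliers of the zero rows `R(a,b,c) = 0` (`c` odd or `b + c > w₀`) -/
  zR : List (List (List ℤ))
  /-- multipliers of the zero rows `R'(a,b,c) = 0` -/
  zRp : List (List (List ℤ))
  /-- multipliers of the translation rows `R(a,b,c) − R(a,w₀−b−c,c) = 0` -/
  tR : List (List (List ℤ))
  /-- multipliers of the translation rows for `R'` -/
  tRp : List (List (List ℤ))
  /-- multipliers of the containment rows `R'(a,b,c) − R(a,b,c) ≥ 0` (`= 0` below `d`) -/
  kap : List (List (List ℤ))
  /-- multiplier of `R(0,0,0) = 1` -/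
  zeta : ℤ
  /-- multiplier of `R(0,w₀,0) = 1` -/
  ups : ℤ
  /-- multipliers (`≥ 0`) of the split rows on the path, in path order -/
  smult : List ℤ

/-- A **refined branch-and-bound certificate**. Column: definition (ours). [cite: MacWilliamsSloane1977, Ch. 17 §4 Thm. 20] -/
inductive RTree where
  /-- a leaf with its multipliers -/
  | leaf (L : RLeaf) : RTree
  /-- split on an integer linear form `≤ v` (left) `∨ ≥ v + 1` (right) -/
  | split (ca cb cw : List ℤ) (cr crp : List (List (List ℤ))) (v : ℤ) (le ge : RTree) : RTree

/-! ### 3. The leaf check: per-unknown combined coefficients -/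

section Check

variable (n k d e w₀ : ℕ)

/-- The transformed point `T x = (x₀+3x₁, x₀−x₁, y₀+y₁+2y₂, y₀+y₁−2y₂, y₀−y₁)`. [cite: CalderbankEtAl1998, §7 (ii)] -/
def tPt (p : ℤ × ℤ × ℤ × ℤ × ℤ) : ℤ × ℤ × ℤ × ℤ × ℤ :=
  (p.1 + 3 * p.2.1, p.1 - p.2.1, p.2.2.1 + p.2.2.2.1 + 2 * p.2.2.2.2, p.2.2.1 + p.2.2.2.1 - 2 * p.2.2.2.2,
    p.2.2.1 - p.2.2.2.1)

/-- The refined monomial at a point. [cite: CalderbankEtAl1998, §7 (ii)] -/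
def monoAt (m w : ℕ) (p : ℤ × ℤ × ℤ × ℤ × ℤ) (a b c : ℕ) : ℤ :=
  refMono m w p.1 p.2.1 p.2.2.1 p.2.2.2.1 p.2.2.2.2 a b c

/-- Split contributions to the coefficient of an unknown: `Σ_i s_i · sgn_i · c_i`. [folklore] -/
def splitCoef : List RSplit → List ℤ → (RSplit → ℤ) → ℤ
  | sp :: sps, y :: ys, f => y * sp.sgn * f sp + splitCoef sps ys f
  | _, _, _ => 0

/-- Split contributions to the right-hand side: `Σ_i s_i · rhs_i`. [folklore] -/
def splitRhs : List RSplit → List ℤ → ℤ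
  | sp :: sps, y :: ys => y * sp.rhs + splitRhs sps ys
  | _, _ => 0

/-- Sign/length check for the split multipliers: all `≥ 0`, same length as the path. [folklore] -/
def splitSignsOK : List RSplit → List ℤ → Bool
  | _ :: sps, y :: ys => decide (0 ≤ y) && splitSignsOK sps ys
  | [], [] => true
  | _, _ => false

/-- Combined coefficient of `A_j`. [cite: MacWilliamsSloane1977, Ch. 17 §4 Thm. 20] -/
def coefA (path : List RSplit) (L : RLeaf) (j : ℕ) : ℤ :=
  combA (baseRows n k d e) L.base j - L.lamR.getD j 0 + splitCoef path L.smult fun s => s.ca.getD j 0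

/-- Combined coefficient of `B_j`. [cite: MacWilliamsSloane1977, Ch. 17 §4 Thm. 20] -/
def coefB (path : List RSplit) (L : RLeaf) (j : ℕ) : ℤ :=
  combB (baseRows n k d e) L.base j - L.lamRp.getD j 0 + splitCoef path L.smult fun s => s.cb.getD j 0

/-- Combined coefficient of `W_j`. [cite: MacWilliamsSloane1977, Ch. 17 §4 Thm. 20] -/
def coefW (path : List RSplit) (L : RLeaf) (j : ℕ) : ℤ :=
  combW (baseRows n k d e) L.base j + splitCoef path L.smult fun s => s.cw.getD j 0

/-- Combined coefficient of `R(a,b,c)` (`(a,b,c)` in the box). [cite: MacWilliamsSloane1977, Ch. 17 §4 Thm. 20] -/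
def coefR (path : List RSplit) (L : RLeaf) (a b c : ℕ) : ℤ :=
  (if b + c ≤ w₀ then
      L.lamR.getD (a + b + c) 0 - (L.pts.map fun q => q.2 * monoAt (n - w₀) w₀ (tPt q.1) a b c).sum +
        (get3 L.tR a b c - get3 L.tR a (w₀ - b - c) c)
    else 0) +
  (if Odd c ∨ w₀ < b + c then get3 L.zR a b c else 0) - get3 L.kap a b c +
  (if a = 0 ∧ b = 0 ∧ c = 0 then L.zeta else 0) + (if a = 0 ∧ b = w₀ ∧ c = 0 then L.ups else 0) +
  splitCoef path L.smult fun s => get3 s.cr a b c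

/-- Combined coefficient of `R'(a,b,c)`. [cite: MacWilliamsSloane1977, Ch. 17 §4 Thm. 20] -/
def coefRp (path : List RSplit) (L : RLeaf) (a b c : ℕ) : ℤ :=
  (if b + c ≤ w₀ then
      L.lamRp.getD (a + b + c) 0 + (2 : ℤ) ^ (n - k) * (L.pts.map fun q => q.2 * monoAt (n - w₀) w₀ q.1 a b c).sum +
        (get3 L.tRp a b c - get3 L.tRp a (w₀ - b - c) c)
    else 0) +
  (if Odd c ∨ w₀ < b + c then get3 L.zRp a b c else 0) + get3 L.kap a b c +
  splitCoef path L.smult fun s => get3 s.crp a b c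

/-- Combined right-hand side. [cite: MacWilliamsSloane1977, Ch. 17 §4 Thm. 20] -/
def leafRhs (path : List RSplit) (L : RLeaf) : ℤ :=
  combRhs (baseRows n k d e) L.base + L.zeta + L.ups + splitRhs path L.smult

/-- **The refined leaf check**: admissible signs, every combined coefficient `≤ 0`, combined right-hand side `> 0`.
Column: definition (ours). [cite: MacWilliamsSloane1977, Ch. 17 §4 Thm. 20] -/
def rleafOK (path : List RSplit) (L : RLeaf) : Bool :=
  decide (w₀ ≤ n) && signsOK (baseRows n k d e) L.base && splitSignsOK path L.smult &&
  ((List.range (n + 1)).all fun j =>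
    decide (coefA n k d e path L j ≤ 0) && decide (coefB n k d e path L j ≤ 0) && decide (coefW n k d e path L j ≤ 0)) &&
  ((List.range (n - w₀ + 1)).all fun a => (List.range (w₀ + 1)).all fun b => (List.range (w₀ + 1)).all fun c =>
    (!(decide (d ≤ a + b + c)) || decide (0 ≤ get3 L.kap a b c)) &&
    decide (coefR n w₀ path L a b c ≤ 0) && decide (coefRp n k w₀ path L a b c ≤ 0)) &&
  decide (0 < leafRhs n k d e path L)

/-- **The refined certificate checker** (pure, `decide`-able). Column: definition (ours).
[cite: MacWilliamsSloane1977, Ch. 17 §4 Thm. 20] -/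
def RTree.checkPath : RTree → List RSplit → Bool
  | .leaf L, path => rleafOK n k d e w₀ path L
  | .split ca cb cw cr crp v le ge, path =>
    le.checkPath (path ++ [⟨ca, cb, cw, cr, crp, v, false⟩]) && ge.checkPath (path ++ [⟨ca, cb, cw, cr, crp, v, true⟩])

/-- The checker for `CRSSRefinedFeasible n k d w₀` in parity branch `e`. [cite: CalderbankEtAl1998, §7 (ii)] -/
def RTree.check (t : RTree) : Bool := t.checkPath n k d e w₀ []

end Check

end Summit.Ventures.QEC.Census
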